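import Summits.QuantumFields.YangMills.Theorems.UnitScaleTiltFluctuationComparisonRegPrSmallFieldRecursion

/-!
# Route `UnitScaleTilt` — crux K1bR-pr `FluctuationComparisonRegPr` (stmt-QuantumFields-19201), stub `stub_logComparisonRegPr`,
# layer S-D/β «SMALL-FIELD ENVELOPE FRAME»: two-sided envelopes, EXPOSED AS DATA, propagate along Bałaban's small-field recursion by
# positivity of the renormalisation transformation — S-D reduced to one-step envelopes on explicit functions
# (support file `--supports stmt-QuantumFields-19201`; the stub stays open)

Fleet lead `ym-ust-19201-p1` (gen 1); split card `CARD-19201-logComparison-split.md` (evidence #16 on the item), sub-lemma **S-D**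
(per-run two-sided trivial-history envelope = [Balaban1985UV3] (41) at the trivial history + (47)).  Builds on the sibling carrier file
`…SmallFieldRecursion` (`τ_{j+1} = T_j(χ_j·τ_j)`, `heightDensity (histGood θ K n) = χ·τ_k ∘ fieldShift` a.e., `T_j` monotone a.e.).
WHAT THIS IS NOT: the ONE-STEP envelopes (= [Balaban1985UV3] Sect. C restricted to small fields: one renormalisation transformation of
`χ_j·exp[−g_j⁻²A(U_j) + Σ𝒫 − E_j ∓ Rm_j]` stays inside the next pair) are NOT proved here — they enter as hypotheses on EXPLICIT envelope
functions `ℓ_j, u_j` (route owner's shape spec 79ec68554fb53705 (2): the (41)-data exposed as arguments, never ∃-bound inside a Prop, so that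
the frame cannot be satisfied vacuously); no estimate of Bałaban's is asserted.

* `sandwich_of_oneStep`: (base) `ℓ_0 ≤ e^{−β_K A} ≤ u_0` on the finest window ∧ (step) `ℓ_{j+1} ≤ T_j(χ_j ℓ_j)`, `T_j(χ_j u_j) ≤ u_{j+1}` a.e. on
  the next window for `j < k` ⇒ `ℓ_j ≤ τ_j ≤ u_j` a.e. on the window of every level `j ≤ k` (induction; positivity of `T_j` p.266).
* `heightDensity_sandwich_of_oneStep`: the same read at the comparison height `n = K − k` for the registered stub's restricted height density.
* `abs_log_heightDensity_sub_le_of_oneStep`: exponential top envelopes `e^{a ∓ R}` ⇒ a.e. on the window the stub's density is positive and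
  `|log heightDensity(V) − a(fieldShift V)| ≤ R` — S-D's shape (`a = −bgRegPr + Pint − E`, `R = Rm` once the (41)-data are of record).

References: T. Bałaban, CMP 102 (1985) 255–275 [Balaban1985UV3] ((41) p.266, (47) p.267, Sect. C pp.267–272).
-/

noncomputable section

open MeasureTheory Filter Topology
open Literature.MathematicalPhysics.QuantumFieldTheory.Balaban1983to89
open Literature.MathematicalPhysics.QuantumFieldTheory.Balaban1983to89.T3ContinuumYM3Torus
open Literature.MathematicalPhysics.QuantumFieldTheory.Balaban1983to89.T3LevelShift
open Literature.MathematicalPhysics.QuantumFieldTheory.Balaban1983to89.T3UnitLawDensityEML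
open Literature.MathematicalPhysics.QuantumFieldTheory.Balaban1983to89.T3UnitScaleTilt
open Literature.MathematicalPhysics.QuantumFieldTheory.Balaban1983to89.T3RestrictedUnitDensity
open Literature.MathematicalPhysics.QuantumFieldTheory.Balaban1983to89.T3TiltDescent
open Literature.MathematicalPhysics.QuantumFieldTheory.Balaban1983to89.T3CruxEstimates
open Literature.MathematicalPhysics.QuantumFieldTheory.Balaban1983to89.Missing
open Literature.MathematicalPhysics.QuantumFieldTheory.Balaban1983to89.T4Continuum
open Summit.QuantumFields.YangMills.Theorems.LogComparisonSmallFieldRecursion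

namespace Summit.QuantumFields.YangMills.Theorems.LogComparisonSmallFieldEnvelope

/-! ## §1 The small-field recursion from an arbitrary initial density; run `K+1` on run `K`'s tower -/

section General

variable (F : T3Family) (K : ℕ) (θ : ℕ → ℝ) {ρ₀ : Density (F.P K) 0 (Matrix.specialUnitaryGroup (Fin 2) ℂ)}

/-- `τ_0[ρ₀] = ρ₀`: with `K + 1` free top steps nothing is restricted. [cite: Balaban1985UV3, (1)-(2) p.256] -/
theorem towerDensity_histGood_zero_eq (ρ₀ : Density (F.P K) 0 (Matrix.specialUnitaryGroup (Fin 2) ℂ)) :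
    towerDensity F K ((histGood F ℰp θ K (K + 1)).indicator ρ₀) 0 = ρ₀ := by
  show (histGood F ℰp θ K (K + 1)).indicator ρ₀ = ρ₀
  rw [histGood_succ_self_eq_univ F K θ ℰp, Set.indicator_univ]

/-- **PEEL-TOP, ARBITRARY INITIAL DENSITY**: for `n + j = K` and an integrable `ρ₀`,
`T^{j}(1_{histGood θ K n}·ρ₀) = 1_{PlaqSmall θ(n)} · T^{j}(1_{histGood θ K (n+1)}·ρ₀)` a.e. [cite: Balaban1985UV3, (7) p.257] -/
theorem towerDensity_histGood_ae_eq_indicator_mul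
    (hi : Integrable ρ₀ (fieldMeasure (F.P K) 0 (Matrix.specialUnitaryGroup (Fin 2) ℂ))) {n j : ℕ} (hnj : n + j = K) :
    towerDensity F K ((histGood F ℰp θ K n).indicator ρ₀) j =ᵐ[fieldMeasure (F.P K) j (Matrix.specialUnitaryGroup (Fin 2) ℂ)]
      {W | PlaqSmall (θ n) W}.indicator (towerDensity F K ((histGood F ℰp θ K (n + 1)).indicator ρ₀) j) := by
  have hS : MeasurableSet (histGood F ℰp θ K (n + 1) :
      Set (GaugeField (F.P K) 0 (Matrix.specialUnitaryGroup (Fin 2) ℂ))) :=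
    measurableSet_histGood F ℰp measurableE_ℰp θ K (n + 1)
  have hind : (histGood F ℰp θ K n).indicator ρ₀ =
      ((Averaging.iter (fun i => BlockAveraging.blockAvg (P := F.P K) (j := i) ℰp) j) ⁻¹' {W | PlaqSmall (θ n) W}).indicator
        ((histGood F ℰp θ K (n + 1)).indicator ρ₀) := by
    rw [histGood_eq_inter_preimage F K θ ℰp hnj, Set.inter_comm, ← Set.indicator_indicator]
  rw [hind]
  exact towerDensity_indicator_preimage_ae_eq F K (hi.indicator hS) (by omega) (measurableSet_plaqSmall _)

/-- **STEP, ARBITRARY INITIAL DENSITY — `τ_{j+1}[ρ₀] = T_j(χ_j·τ_j[ρ₀])`** as an identity of functions (`ρ₀ ≥ 0` integrable, `n + j = K`,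
`j + 1` in the standing range). [cite: Balaban1985UV3, (2) p.256 and (7) p.257] -/
theorem towerDensity_histGood_succ_eq_rt_indicator (h0 : ∀ U, 0 ≤ ρ₀ U)
    (hi : Integrable ρ₀ (fieldMeasure (F.P K) 0 (Matrix.specialUnitaryGroup (Fin 2) ℂ))) {n j : ℕ} (hnj : n + j = K)
    (hj : j + 1 ≤ F.m + K) :
    towerDensity F K ((histGood F ℰp θ K n).indicator ρ₀) (j + 1) =
      (rt F K j hj).T ({W | PlaqSmall (θ n) W}.indicator (towerDensity F K ((histGood F ℰp θ K (n + 1)).indicator ρ₀) j)) := by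
  have h0n : ∀ U, 0 ≤ (histGood F ℰp θ K n).indicator ρ₀ U := fun U => Set.indicator_nonneg (fun U _ => h0 U) U
  have h0s : ∀ U, 0 ≤ (histGood F ℰp θ K (n + 1)).indicator ρ₀ U := fun U => Set.indicator_nonneg (fun U _ => h0 U) U
  rw [towerDensity_succ F K _ hj]
  exact rt_congr_ae F K hj (towerDensity_nonneg F K h0n j)
    (fun W => Set.indicator_nonneg (fun W _ => towerDensity_nonneg F K h0s j W) W)
    (towerDensity_histGood_ae_eq_indicator_mul F K θ hi hnj)

variable {γ : ℝ} (hγ : 0 ≤ γ)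
include hγ

/-- **RUN `K+1`'s REGISTERED DENSITY ON RUN `K`'s RECURSION**: for `n ≤ K`, run `K+1`'s restricted height density on `histGood θ (K+1) n`
equals a.e. the window's indicator times `τ_{K−n}[w_K]` read through the level identification, `w_K = T₀^{(K+1)}(1_{PlaqSmall θ(K+1)}e^{−β_{K+1}A}) ∘ e₀⁻¹`
the one-step renormalised weight (one-tower normal form of ★ym-ust-19201-p2 + PEEL-TOP). [cite: King1986, §3.2 p.656] -/
theorem heightDensity_succ_histGood_ae_eq {n : ℕ} (hK : n ≤ K) :
    heightDensity F γ (hK.trans (Nat.le_succ K)) (histGood F ℰp θ (K + 1) n) =ᵐ[fieldMeasure (F.P n) 0 (Matrix.specialUnitaryGroup (Fin 2) ℂ)]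
      fun V => {V' : GaugeField (F.P n) 0 (Matrix.specialUnitaryGroup (Fin 2) ℂ) | PlaqSmall (θ n) V'}.indicator
        (fun V' => towerDensity F K ((histGood F ℰp θ K (n + 1)).indicator (fun U => resDensity F γ (K + 1) {U' | PlaqSmall (θ (K + 1)) U'} 1
            (fieldShift (F.sitesPerDir_eq (m := F.m) (K := K + 1) (j := 1) (m' := F.m) (K' := K) (j' := 0) (by omega)) U))) (K - n)
          (fieldShift (F.sitesPerDir_eq (m := F.m) (K := K) (j := K - n) (m' := F.m) (K' := n) (j' := 0) (by omega)) V')) V := by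
  have hup := F.sitesPerDir_eq (m := F.m) (K := K) (j := K - n) (m' := F.m) (K' := n) (j' := 0) (by omega)
  have hSA := LogComparisonOneTower.heightDensity_succ_ae_eq F hγ K θ hK
  have hpeel := towerDensity_histGood_ae_eq_indicator_mul F K θ
    (LogComparisonOneTower.integrable_oneStepWeight F K θ hγ) (n := n) (j := K - n) (by omega)
  have hq : Measure.QuasiMeasurePreserving
      (fieldShift hup : GaugeField (F.P n) 0 (Matrix.specialUnitaryGroup (Fin 2) ℂ) → GaugeField (F.P K) (K - n) (Matrix.specialUnitaryGroup (Fin 2) ℂ))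
      (fieldMeasure (F.P n) 0 (Matrix.specialUnitaryGroup (Fin 2) ℂ)) (fieldMeasure (F.P K) (K - n) (Matrix.specialUnitaryGroup (Fin 2) ℂ)) :=
    (measurePreserving_fieldShift hup).quasiMeasurePreserving
  refine hSA.trans ((hq.ae_eq_comp hpeel).trans (Eventually.of_forall fun V => ?_))
  show {W : GaugeField (F.P K) (K - n) (Matrix.specialUnitaryGroup (Fin 2) ℂ) | PlaqSmall (θ n) W}.indicator
      (towerDensity F K ((histGood F ℰp θ K (n + 1)).indicator (fun U => resDensity F γ (K + 1) {U' | PlaqSmall (θ (K + 1)) U'} 1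
            (fieldShift (F.sitesPerDir_eq (m := F.m) (K := K + 1) (j := 1) (m' := F.m) (K' := K) (j' := 0) (by omega)) U))) (K - n))
        (fieldShift hup V) =
    {V' : GaugeField (F.P n) 0 (Matrix.specialUnitaryGroup (Fin 2) ℂ) | PlaqSmall (θ n) V'}.indicator
      (fun V' => towerDensity F K ((histGood F ℰp θ K (n + 1)).indicator (fun U => resDensity F γ (K + 1) {U' | PlaqSmall (θ (K + 1)) U'} 1
            (fieldShift (F.sitesPerDir_eq (m := F.m) (K := K + 1) (j := 1) (m' := F.m) (K' := K) (j' := 0) (by omega)) U))) (K - n)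
          (fieldShift hup V')) V
  by_cases hV : PlaqSmall (θ n) V
  · have hV' : PlaqSmall (θ n) (fieldShift hup V) := (plaqSmall_fieldShift F hup _ V).mpr hV
    exact (Set.indicator_of_mem hV' _).trans
      (Set.indicator_of_mem (f := fun V' => towerDensity F K ((histGood F ℰp θ K (n + 1)).indicator (fun U =>
        resDensity F γ (K + 1) {U' | PlaqSmall (θ (K + 1)) U'} 1
          (fieldShift (F.sitesPerDir_eq (m := F.m) (K := K + 1) (j := 1) (m' := F.m) (K' := K) (j' := 0) (by omega)) U))) (K - n)
            (fieldShift hup V')) hV).symm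
  · have hV' : ¬ PlaqSmall (θ n) (fieldShift hup V) := fun h => hV ((plaqSmall_fieldShift F hup _ V).mp h)
    exact (Set.indicator_of_notMem hV' _).trans
      (Set.indicator_of_notMem (f := fun V' => towerDensity F K ((histGood F ℰp θ K (n + 1)).indicator (fun U =>
        resDensity F γ (K + 1) {U' | PlaqSmall (θ (K + 1)) U'} 1
          (fieldShift (F.sitesPerDir_eq (m := F.m) (K := K + 1) (j := 1) (m' := F.m) (K' := K) (j' := 0) (by omega)) U))) (K - n)
            (fieldShift hup V')) hV).symm

end General

/-! ## §2 The induction frame of S-D: envelopes exposed as data propagate along the recursion -/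

section Frame

variable (F : T3Family) (K : ℕ) (θ : ℕ → ℝ) {ρ₀ : Density (F.P K) 0 (Matrix.specialUnitaryGroup (Fin 2) ℂ)}
  (ℓ u : (j : ℕ) → Density (F.P K) j (Matrix.specialUnitaryGroup (Fin 2) ℂ))

/-- Pure real analysis: an exponential sandwich `e^{a−R} ≤ x ≤ e^{a+R}` is positivity and `|log x − a| ≤ R`. [folklore] -/
theorem pos_and_abs_log_sub_le_of_exp_sandwich {x a R : ℝ} (h1 : Real.exp (a - R) ≤ x) (h2 : x ≤ Real.exp (a + R)) :
    0 < x ∧ |Real.log x - a| ≤ R := by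
  have hpos : 0 < x := (Real.exp_pos _).trans_le h1
  refine ⟨hpos, abs_le.mpr ⟨?_, ?_⟩⟩
  · have := Real.log_le_log (Real.exp_pos _) h1
    rw [Real.log_exp] at this
    linarith
  · have := Real.log_le_log hpos h2
    rw [Real.log_exp] at this
    linarith

/-- **SANDWICH PROPAGATION ALONG THE SMALL-FIELD RECURSION** (the induction of [Balaban1985UV3] Sects. B–C with every large-field term absent,
its ANALYTIC STEP TAKEN AS A HYPOTHESIS ON EXPLICIT FUNCTIONS), from an arbitrary integrable initial density `ρ₀ ≥ 0`: let `ℓ_j, u_j` be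
integrable lower/upper envelope functions on the levels `j ≤ k` (`k ≤ K`) such that (base) `ℓ_0 ≤ ρ₀ ≤ u_0` a.e. on the finest window and
(step) for every `j < k`, a.e. on the window of level `j + 1`, `ℓ_{j+1} ≤ T_j(χ_j ℓ_j)` and `T_j(χ_j u_j) ≤ u_{j+1}` — one renormalisation
transformation of the restricted envelopes stays inside the next envelopes (in print: `ℓ_j, u_j = exp[−g_j⁻²A(U_j) + Σ𝒫 − E_j ∓ Rm_j]`, the content
of (41)↾trivial history and (47)).  THEN `ℓ_j ≤ τ_j[ρ₀] ≤ u_j` a.e. on the window of every level `j ≤ k` — by positivity of `T_j` and the recursion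
`τ_{j+1} = T_j(χ_j τ_j)` alone. [cite: Balaban1985UV3, (41) p.266 and (47) p.267] -/
theorem sandwich_of_oneStep (h0 : ∀ U, 0 ≤ ρ₀ U) (hi : Integrable ρ₀ (fieldMeasure (F.P K) 0 (Matrix.specialUnitaryGroup (Fin 2) ℂ)))
    {k : ℕ} (hk : k ≤ K)
    (hℓi : ∀ j, j ≤ k → Integrable (ℓ j) (fieldMeasure (F.P K) j (Matrix.specialUnitaryGroup (Fin 2) ℂ)))
    (hui : ∀ j, j ≤ k → Integrable (u j) (fieldMeasure (F.P K) j (Matrix.specialUnitaryGroup (Fin 2) ℂ)))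
    (hbase : ∀ᵐ W ∂fieldMeasure (F.P K) 0 (Matrix.specialUnitaryGroup (Fin 2) ℂ), PlaqSmall (θ K) W → ℓ 0 W ≤ ρ₀ W ∧ ρ₀ W ≤ u 0 W)
    (hstep : ∀ (j : ℕ) (hj : j + 1 ≤ k), ∀ᵐ W ∂fieldMeasure (F.P K) (j + 1) (Matrix.specialUnitaryGroup (Fin 2) ℂ),
      PlaqSmall (θ (K - (j + 1))) W →
        ℓ (j + 1) W ≤ (rt F K j (by omega)).T ({W' | PlaqSmall (θ (K - j)) W'}.indicator (ℓ j)) W ∧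
        (rt F K j (by omega)).T ({W' | PlaqSmall (θ (K - j)) W'}.indicator (u j)) W ≤ u (j + 1) W) :
    ∀ j, j ≤ k → ∀ᵐ W ∂fieldMeasure (F.P K) j (Matrix.specialUnitaryGroup (Fin 2) ℂ), PlaqSmall (θ (K - j)) W →
      ℓ j W ≤ towerDensity F K ((histGood F ℰp θ K (K - j + 1)).indicator ρ₀) j W ∧
      towerDensity F K ((histGood F ℰp θ K (K - j + 1)).indicator ρ₀) j W ≤ u j W := by
  intro j
  induction j with
  | zero =>
    intro _
    rw [Nat.sub_zero, towerDensity_histGood_zero_eq F K θ ρ₀]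
    exact hbase
  | succ j ih =>
    intro hj
    have hjk : j ≤ k := by omega
    have hj1 : j + 1 ≤ F.m + K := by omega
    have hKj : K - j + j = K := by omega
    have ihj := ih hjk
    have hχ : MeasurableSet {W' : GaugeField (F.P K) j (Matrix.specialUnitaryGroup (Fin 2) ℂ) | PlaqSmall (θ (K - j)) W'} :=
      measurableSet_plaqSmall _
    have hS : MeasurableSet (histGood F ℰp θ K (K - j + 1) :
        Set (GaugeField (F.P K) 0 (Matrix.specialUnitaryGroup (Fin 2) ℂ))) :=
      measurableSet_histGood F ℰp measurableE_ℰp θ K _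
    have hτi : Integrable (towerDensity F K ((histGood F ℰp θ K (K - j + 1)).indicator ρ₀) j)
        (fieldMeasure (F.P K) j (Matrix.specialUnitaryGroup (Fin 2) ℂ)) :=
      integrable_towerDensity F K (hi.indicator hS) j (by omega)
    -- the restricted envelopes sandwich the restricted `τ_j` a.e. (off the window all three vanish)
    have hle₁ : {W' | PlaqSmall (θ (K - j)) W'}.indicator (ℓ j) ≤ᵐ[fieldMeasure (F.P K) j (Matrix.specialUnitaryGroup (Fin 2) ℂ)]
        {W' | PlaqSmall (θ (K - j)) W'}.indicator (towerDensity F K ((histGood F ℰp θ K (K - j + 1)).indicator ρ₀) j) :=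
      ihj.mono fun W hW => by
        by_cases hWs : PlaqSmall (θ (K - j)) W
        · rw [Set.indicator_of_mem hWs, Set.indicator_of_mem hWs]
          exact (hW hWs).1
        · rw [Set.indicator_of_notMem hWs, Set.indicator_of_notMem hWs]
    have hle₂ : {W' | PlaqSmall (θ (K - j)) W'}.indicator (towerDensity F K ((histGood F ℰp θ K (K - j + 1)).indicator ρ₀) j)
          ≤ᵐ[fieldMeasure (F.P K) j (Matrix.specialUnitaryGroup (Fin 2) ℂ)]
        {W' | PlaqSmall (θ (K - j)) W'}.indicator (u j) :=
      ihj.mono fun W hW => by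
        by_cases hWs : PlaqSmall (θ (K - j)) W
        · rw [Set.indicator_of_mem hWs, Set.indicator_of_mem hWs]
          exact (hW hWs).2
        · rw [Set.indicator_of_notMem hWs, Set.indicator_of_notMem hWs]
    -- positivity of `T_j`
    have hT₁ := rt_mono_ae F K hj1 ((hℓi j hjk).indicator hχ) (hτi.indicator hχ) hle₁
    have hT₂ := rt_mono_ae F K hj1 (hτi.indicator hχ) ((hui j hjk).indicator hχ) hle₂
    -- the recursion `τ_{j+1} = T_j(χ_j τ_j)`
    have hrec := towerDensity_histGood_succ_eq_rt_indicator F K θ h0 hi (n := K - j) (j := j) hKj hj1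
    have e : K - (j + 1) + 1 = K - j := by omega
    rw [e, hrec]
    filter_upwards [hT₁, hT₂, hstep j hj] with W h1 h2 hs hWs
    obtain ⟨hs1, hs2⟩ := hs hWs
    exact ⟨hs1.trans h1, h2.trans hs2⟩

end Frame

/-! ## §3 At the comparison height: the registered stub's densities of run `K` and of run `K+1` -/

section Height

variable (F : T3Family) {γ : ℝ} (hγ : 0 ≤ γ) (K : ℕ) (θ : ℕ → ℝ)
  (ℓ u : (j : ℕ) → Density (F.P K) j (Matrix.specialUnitaryGroup (Fin 2) ℂ))

include hγ

/-- **RUN `K`** (`ρ₀ = e^{−β_K A}`): under the hypotheses of `sandwich_of_oneStep` with `k = K − n`, for a.e. `V` on the window `PlaqSmall θ(n)` of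
the comparison lattice, `ℓ_k(fieldShift V) ≤ heightDensity F γ _ (histGood θ K n) V ≤ u_k(fieldShift V)` — S-D's two-sided envelope for run
`K` follows from ONE-STEP envelopes on explicit functions. [cite: Balaban1985UV3, (41) p.266 and (47) p.267] -/
theorem heightDensity_sandwich_of_oneStep {n : ℕ} (hK : n ≤ K)
    (hℓi : ∀ j, j ≤ K - n → Integrable (ℓ j) (fieldMeasure (F.P K) j (Matrix.specialUnitaryGroup (Fin 2) ℂ)))
    (hui : ∀ j, j ≤ K - n → Integrable (u j) (fieldMeasure (F.P K) j (Matrix.specialUnitaryGroup (Fin 2) ℂ)))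
    (hbase : ∀ᵐ W ∂fieldMeasure (F.P K) 0 (Matrix.specialUnitaryGroup (Fin 2) ℂ), PlaqSmall (θ K) W →
      ℓ 0 W ≤ boltzmann (F.P K) ((F.scheme ℰp γ).β K) W ∧ boltzmann (F.P K) ((F.scheme ℰp γ).β K) W ≤ u 0 W)
    (hstep : ∀ (j : ℕ) (hj : j + 1 ≤ K - n), ∀ᵐ W ∂fieldMeasure (F.P K) (j + 1) (Matrix.specialUnitaryGroup (Fin 2) ℂ),
      PlaqSmall (θ (K - (j + 1))) W →
        ℓ (j + 1) W ≤ (rt F K j (by omega)).T ({W' | PlaqSmall (θ (K - j)) W'}.indicator (ℓ j)) W ∧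
        (rt F K j (by omega)).T ({W' | PlaqSmall (θ (K - j)) W'}.indicator (u j)) W ≤ u (j + 1) W) :
    ∀ᵐ V ∂fieldMeasure (F.P n) 0 (Matrix.specialUnitaryGroup (Fin 2) ℂ), PlaqSmall (θ n) V →
      ℓ (K - n) (fieldShift (F.sitesPerDir_eq (m := F.m) (K := K) (j := K - n) (m' := F.m) (K' := n) (j' := 0) (by omega)) V) ≤
          heightDensity F γ hK (histGood F ℰp θ K n) V ∧
        heightDensity F γ hK (histGood F ℰp θ K n) V ≤
          u (K - n) (fieldShift (F.sitesPerDir_eq (m := F.m) (K := K) (j := K - n) (m' := F.m) (K' := n) (j' := 0) (by omega)) V) := by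
  have hup := F.sitesPerDir_eq (m := F.m) (K := K) (j := K - n) (m' := F.m) (K' := n) (j' := 0) (by omega)
  have hsw := sandwich_of_oneStep F K θ ℓ u (fun U => (boltzmann_pos _ _ U).le)
    (integrable_boltzmann RegularGaugeGroup.measurable_reTr _ (F.scheme_β_nonneg ℰp hγ K))
    (k := K - n) (Nat.sub_le K n) hℓi hui hbase hstep (K - n) le_rfl
  rw [show K - (K - n) = n by omega] at hsw
  have hq : Measure.QuasiMeasurePreserving
      (fieldShift hup : GaugeField (F.P n) 0 (Matrix.specialUnitaryGroup (Fin 2) ℂ) → GaugeField (F.P K) (K - n) (Matrix.specialUnitaryGroup (Fin 2) ℂ))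
      (fieldMeasure (F.P n) 0 (Matrix.specialUnitaryGroup (Fin 2) ℂ)) (fieldMeasure (F.P K) (K - n) (Matrix.specialUnitaryGroup (Fin 2) ℂ)) :=
    (measurePreserving_fieldShift hup).quasiMeasurePreserving
  filter_upwards [hq.ae hsw, heightDensity_histGood_eq_on_window F K θ hγ hK] with V hV hW hs
  rw [hW hs]
  exact hV ((plaqSmall_fieldShift F hup _ V).mpr hs)

/-- **RUN `K+1` ON RUN `K`'s TOWER** (`ρ₀ = w_K`, the one-step renormalised weight): envelopes along run `K`'s levels with (base)
`ℓ_0 ≤ w_K ≤ u_0` on the finest window (= an envelope for the FIRST renormalisation step of run `K+1`, [Balaban1985UV3] Sect. A (36)–(37)) and the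
one-step propagation give, for a.e. `V` on the window, `ℓ_k(fieldShift V) ≤ heightDensity F γ _ (histGood θ (K+1) n) V ≤ u_k(fieldShift V)`,
`k = K − n` ([King1986] §3.2: the two runs as two models on the same lattices). [cite: King1986, §3.2 p.656] -/
theorem heightDensity_succ_sandwich_of_oneStep {n : ℕ} (hK : n ≤ K)
    (hℓi : ∀ j, j ≤ K - n → Integrable (ℓ j) (fieldMeasure (F.P K) j (Matrix.specialUnitaryGroup (Fin 2) ℂ)))
    (hui : ∀ j, j ≤ K - n → Integrable (u j) (fieldMeasure (F.P K) j (Matrix.specialUnitaryGroup (Fin 2) ℂ)))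
    (hbase : ∀ᵐ W ∂fieldMeasure (F.P K) 0 (Matrix.specialUnitaryGroup (Fin 2) ℂ), PlaqSmall (θ K) W →
      ℓ 0 W ≤ resDensity F γ (K + 1) {U' | PlaqSmall (θ (K + 1)) U'} 1
            (fieldShift (F.sitesPerDir_eq (m := F.m) (K := K + 1) (j := 1) (m' := F.m) (K' := K) (j' := 0) (by omega)) W) ∧
        resDensity F γ (K + 1) {U' | PlaqSmall (θ (K + 1)) U'} 1
            (fieldShift (F.sitesPerDir_eq (m := F.m) (K := K + 1) (j := 1) (m' := F.m) (K' := K) (j' := 0) (by omega)) W) ≤ u 0 W)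
    (hstep : ∀ (j : ℕ) (hj : j + 1 ≤ K - n), ∀ᵐ W ∂fieldMeasure (F.P K) (j + 1) (Matrix.specialUnitaryGroup (Fin 2) ℂ),
      PlaqSmall (θ (K - (j + 1))) W →
        ℓ (j + 1) W ≤ (rt F K j (by omega)).T ({W' | PlaqSmall (θ (K - j)) W'}.indicator (ℓ j)) W ∧
        (rt F K j (by omega)).T ({W' | PlaqSmall (θ (K - j)) W'}.indicator (u j)) W ≤ u (j + 1) W) :
    ∀ᵐ V ∂fieldMeasure (F.P n) 0 (Matrix.specialUnitaryGroup (Fin 2) ℂ), PlaqSmall (θ n) V →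
      ℓ (K - n) (fieldShift (F.sitesPerDir_eq (m := F.m) (K := K) (j := K - n) (m' := F.m) (K' := n) (j' := 0) (by omega)) V) ≤
          heightDensity F γ (hK.trans (Nat.le_succ K)) (histGood F ℰp θ (K + 1) n) V ∧
        heightDensity F γ (hK.trans (Nat.le_succ K)) (histGood F ℰp θ (K + 1) n) V ≤
          u (K - n) (fieldShift (F.sitesPerDir_eq (m := F.m) (K := K) (j := K - n) (m' := F.m) (K' := n) (j' := 0) (by omega)) V) := by
  have hup := F.sitesPerDir_eq (m := F.m) (K := K) (j := K - n) (m' := F.m) (K' := n) (j' := 0) (by omega)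
  have hsw := sandwich_of_oneStep F K θ ℓ u (LogComparisonOneTower.oneStepWeight_nonneg F γ K θ)
    (LogComparisonOneTower.integrable_oneStepWeight F K θ hγ)
    (k := K - n) (Nat.sub_le K n) hℓi hui hbase hstep (K - n) le_rfl
  rw [show K - (K - n) = n by omega] at hsw
  have hq : Measure.QuasiMeasurePreserving
      (fieldShift hup : GaugeField (F.P n) 0 (Matrix.specialUnitaryGroup (Fin 2) ℂ) → GaugeField (F.P K) (K - n) (Matrix.specialUnitaryGroup (Fin 2) ℂ))
      (fieldMeasure (F.P n) 0 (Matrix.specialUnitaryGroup (Fin 2) ℂ)) (fieldMeasure (F.P K) (K - n) (Matrix.specialUnitaryGroup (Fin 2) ℂ)) :=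
    (measurePreserving_fieldShift hup).quasiMeasurePreserving
  filter_upwards [hq.ae hsw, heightDensity_succ_histGood_ae_eq F K θ hγ hK] with V hV hW hs
  have e : heightDensity F γ (hK.trans (Nat.le_succ K)) (histGood F ℰp θ (K + 1) n) V =
      towerDensity F K ((histGood F ℰp θ K (n + 1)).indicator (fun U => resDensity F γ (K + 1) {U' | PlaqSmall (θ (K + 1)) U'} 1
            (fieldShift (F.sitesPerDir_eq (m := F.m) (K := K + 1) (j := 1) (m' := F.m) (K' := K) (j' := 0) (by omega)) U))) (K - n)
          (fieldShift hup V) :=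
    hW.trans (Set.indicator_of_mem (f := fun V' => towerDensity F K ((histGood F ℰp θ K (n + 1)).indicator (fun U =>
        resDensity F γ (K + 1) {U' | PlaqSmall (θ (K + 1)) U'} 1
          (fieldShift (F.sitesPerDir_eq (m := F.m) (K := K + 1) (j := 1) (m' := F.m) (K' := K) (j' := 0) (by omega)) U))) (K - n)
            (fieldShift hup V')) hs)
  rw [e]
  exact hV ((plaqSmall_fieldShift F hup _ V).mpr hs)

/-- **S-D's SHAPE — THE LOG FORM, RUN `K`**: if moreover the top envelopes are exponential, `ℓ_k = e^{a − R}`, `u_k = e^{a + R}` for an explicit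
function `a` on the level-`k` fields (in print `a = −g_k⁻²A(U_k(·)) + Σ_jΣ_Y 𝒫_j − E_k`, `R = Rm_k`), then for a.e. `V` on the window the stub's
restricted height density is positive and `|log heightDensity(V) − a(fieldShift V)| ≤ R` — the per-run two-sided trivial-history envelope of the
split card (S-D), reduced to `k` one-step envelopes on explicit functions. [cite: Balaban1985UV3, (41) p.266 and (47) p.267] -/
theorem abs_log_heightDensity_sub_le_of_oneStep {n : ℕ} (hK : n ≤ K)
    (a : GaugeField (F.P K) (K - n) (Matrix.specialUnitaryGroup (Fin 2) ℂ) → ℝ) (R : ℝ)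
    (hℓk : ∀ W, ℓ (K - n) W = Real.exp (a W - R)) (huk : ∀ W, u (K - n) W = Real.exp (a W + R))
    (hℓi : ∀ j, j ≤ K - n → Integrable (ℓ j) (fieldMeasure (F.P K) j (Matrix.specialUnitaryGroup (Fin 2) ℂ)))
    (hui : ∀ j, j ≤ K - n → Integrable (u j) (fieldMeasure (F.P K) j (Matrix.specialUnitaryGroup (Fin 2) ℂ)))
    (hbase : ∀ᵐ W ∂fieldMeasure (F.P K) 0 (Matrix.specialUnitaryGroup (Fin 2) ℂ), PlaqSmall (θ K) W →
      ℓ 0 W ≤ boltzmann (F.P K) ((F.scheme ℰp γ).β K) W ∧ boltzmann (F.P K) ((F.scheme ℰp γ).β K) W ≤ u 0 W)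
    (hstep : ∀ (j : ℕ) (hj : j + 1 ≤ K - n), ∀ᵐ W ∂fieldMeasure (F.P K) (j + 1) (Matrix.specialUnitaryGroup (Fin 2) ℂ),
      PlaqSmall (θ (K - (j + 1))) W →
        ℓ (j + 1) W ≤ (rt F K j (by omega)).T ({W' | PlaqSmall (θ (K - j)) W'}.indicator (ℓ j)) W ∧
        (rt F K j (by omega)).T ({W' | PlaqSmall (θ (K - j)) W'}.indicator (u j)) W ≤ u (j + 1) W) :
    ∀ᵐ V ∂fieldMeasure (F.P n) 0 (Matrix.specialUnitaryGroup (Fin 2) ℂ), PlaqSmall (θ n) V →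
      0 < heightDensity F γ hK (histGood F ℰp θ K n) V ∧
        |Real.log (heightDensity F γ hK (histGood F ℰp θ K n) V) -
            a (fieldShift (F.sitesPerDir_eq (m := F.m) (K := K) (j := K - n) (m' := F.m) (K' := n) (j' := 0) (by omega)) V)| ≤ R := by
  filter_upwards [heightDensity_sandwich_of_oneStep F hγ K θ ℓ u hK hℓi hui hbase hstep] with V hV hs
  obtain ⟨h1, h2⟩ := hV hs
  rw [hℓk] at h1
  rw [huk] at h2
  exact pos_and_abs_log_sub_le_of_exp_sandwich h1 h2

/-- **THE LOG FORM, RUN `K+1`** (on run `K`'s tower, started from `w_K`). [cite: King1986, §3.2 p.656] -/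
theorem abs_log_heightDensity_succ_sub_le_of_oneStep {n : ℕ} (hK : n ≤ K)
    (a : GaugeField (F.P K) (K - n) (Matrix.specialUnitaryGroup (Fin 2) ℂ) → ℝ) (R : ℝ)
    (hℓk : ∀ W, ℓ (K - n) W = Real.exp (a W - R)) (huk : ∀ W, u (K - n) W = Real.exp (a W + R))
    (hℓi : ∀ j, j ≤ K - n → Integrable (ℓ j) (fieldMeasure (F.P K) j (Matrix.specialUnitaryGroup (Fin 2) ℂ)))
    (hui : ∀ j, j ≤ K - n → Integrable (u j) (fieldMeasure (F.P K) j (Matrix.specialUnitaryGroup (Fin 2) ℂ)))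
    (hbase : ∀ᵐ W ∂fieldMeasure (F.P K) 0 (Matrix.specialUnitaryGroup (Fin 2) ℂ), PlaqSmall (θ K) W →
      ℓ 0 W ≤ resDensity F γ (K + 1) {U' | PlaqSmall (θ (K + 1)) U'} 1
            (fieldShift (F.sitesPerDir_eq (m := F.m) (K := K + 1) (j := 1) (m' := F.m) (K' := K) (j' := 0) (by omega)) W) ∧
        resDensity F γ (K + 1) {U' | PlaqSmall (θ (K + 1)) U'} 1
            (fieldShift (F.sitesPerDir_eq (m := F.m) (K := K + 1) (j := 1) (m' := F.m) (K' := K) (j' := 0) (by omega)) W) ≤ u 0 W)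
    (hstep : ∀ (j : ℕ) (hj : j + 1 ≤ K - n), ∀ᵐ W ∂fieldMeasure (F.P K) (j + 1) (Matrix.specialUnitaryGroup (Fin 2) ℂ),
      PlaqSmall (θ (K - (j + 1))) W →
        ℓ (j + 1) W ≤ (rt F K j (by omega)).T ({W' | PlaqSmall (θ (K - j)) W'}.indicator (ℓ j)) W ∧
        (rt F K j (by omega)).T ({W' | PlaqSmall (θ (K - j)) W'}.indicator (u j)) W ≤ u (j + 1) W) :
    ∀ᵐ V ∂fieldMeasure (F.P n) 0 (Matrix.specialUnitaryGroup (Fin 2) ℂ), PlaqSmall (θ n) V →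
      0 < heightDensity F γ (hK.trans (Nat.le_succ K)) (histGood F ℰp θ (K + 1) n) V ∧
        |Real.log (heightDensity F γ (hK.trans (Nat.le_succ K)) (histGood F ℰp θ (K + 1) n) V) -
            a (fieldShift (F.sitesPerDir_eq (m := F.m) (K := K) (j := K - n) (m' := F.m) (K' := n) (j' := 0) (by omega)) V)| ≤ R := by
  filter_upwards [heightDensity_succ_sandwich_of_oneStep F hγ K θ ℓ u hK hℓi hui hbase hstep] with V hV hs
  obtain ⟨h1, h2⟩ := hV hs
  rw [hℓk] at h1
  rw [huk] at h2
  exact pos_and_abs_log_sub_le_of_exp_sandwich h1 h2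

end Height

end Summit.QuantumFields.YangMills.Theorems.LogComparisonSmallFieldEnvelope

end
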